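import Summits.HubbardSuperconductivity.HubbardSuperconductivity.Theorems.AnisotropyChordTransferFibre3FinXBEval
import Summits.HubbardSuperconductivity.HubbardSuperconductivity.Theorems.AnisotropyChordTransferFibre3FinRCCell

/-!
# Route `AnisotropyChord` / H0 rotor rung: FIN small-`L` evaluator of the row-C (KT-2b″) brackets on a λ-cell (computable, zero data)

The per-`L` FIN certificate of the off-pole tail crux `OffPoleTailAbs` is fed to p1's
`KT2Assembly.offPoleTailAbs_of_brackets` (`cs2 ≤ Chi`, `‖C0′‖² ≤ Nhi`, `Plo = Llo = 0`, `Tlo ≤ T⁺ ≤ Thi`).  THIS FILE computes those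
brackets on one `λ·D`-cell from g4's row–column tables (`fTab4` profile, `gTab4` `x̂`-gradient per momentum) and the row-`N₁`
objects of `…FinXBEval` (`T⁺` brackets from `Q = ⟨Π⁰,C0⟩`, `P = ‖Π⁰‖²`):
* `gradAt` — `D_e f` in the four directions as index maps of the `x̂`-gradient table (swap symmetry of the ground profile);
* `xcM` (`sup |f|` in fixed point), `xcQ0` (`Σf⁴`), `xcRbar` (`Σ_{a∉{0,x̂}} (D_x f)²`), `xcX` (the `K₁` phase-defect moment),
  `xcPsi` (`Ψ`), `xcC0x`/`xcRowSum` (`Σ_{b∉{0,x̂}} C0(x̂,b)²` by p1's `C0Explicit`), `xcChi` (p1's `Cs2RealSpaceBound` right side),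
  `xcNhi` (`(9/4)M²Ψ + 12·rowsum`, p1's `C0FreeBound` + `shell_reduction`), `tPlusLo`;
* ★ `xbcCellOK L la lb c b` — the COMBINED row-`N₁` + row-C cell certificate (the `N₁` conjunct is literally `xbCellOK`'s), with
  `(3√Chi⁺ + 3√Nhi⁺)² ≤ b · η⁻ · (2ε₁⁻ − Thi) · 3V² · Tlo`, `0 ≤ Tlo`, `Thi ≤ 2ε₁⁻`, `0 ≤ b`.
Soundness: `…Fibre3FinXCSound`.  Prover seat `hubbard-h0-rotor-p3` g5; helper for piece A = stmt-HubbardSuperconductivity-23918 of rung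
19089 (`--supports`, helper class).  WHAT THIS IS NOT: nothing here proves superconductivity in the Hubbard model (rotor TARGET as
worded stays FALSE, g15 verdict); evaluator infrastructure for ONE conditional reduction.  Tree imports only; no sorry, no new axioms.
-/

set_option linter.dupNamespace false
set_option autoImplicit false

namespace Summit.HubbardSuperconductivity.HubbardSuperconductivity.Theorems.AnisotropyChord.Transfer.Fibre3

namespace FinXB

open Hole2 FinCell

/-! ## Gradients in the four directions from the `x̂`-table -/

/-- `D_e f(r)` for `e = x̂, −x̂, ŷ, −ŷ` (`j = 0,1,2,3`) from the `x̂`-gradient table `gx`: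
`D_{−x̂}f(r) = −D_{x̂}f(r + x̂)`, `D_ŷ f(r₁,r₂) = D_{x̂} f(r₂,r₁)` (swap symmetry), `D_{−ŷ} f(r₁,r₂) = −D_{x̂} f(r₂+1, r₁)`. [folklore] -/
def gradAt (L : ℕ) (gx : List (List Iv)) (j r1 r2 : ℕ) : Iv :=
  if j = 0 then getF gx r1 r2
  else if j = 1 then ineg (getF gx ((r1 + 1) % L) r2)
  else if j = 2 then getF gx r2 r1
  else ineg (getF gx ((r2 + 1) % L) r1)

/-- the opposite direction: `x̂ ↔ −x̂`, `ŷ ↔ −ŷ`. [folklore] -/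
def negDir (j : ℕ) : ℕ := if j = 0 then 1 else if j = 1 then 0 else if j = 2 then 3 else 2

/-! ## Real-space sums on the cell -/

/-- `sup_r |f(r)|·D` as an integer upper bound from the table. [folklore] -/
def xcM (L : ℕ) (ft : List (List Iv)) : ℤ :=
  (List.range L).foldr (fun r1 acc => (List.range L).foldr (fun r2 acc' =>
    max acc' (max (-(getF ft r1 r2).1) (getF ft r1 r2).2)) acc) 0

/-- the CHECK that `Mz` bounds every table end: `−lo ≤ Mz`, `hi ≤ Mz` (soundness uses only this). [folklore] -/
def xcMok (L : ℕ) (ft : List (List Iv)) (Mz : ℤ) : Bool :=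
  (List.range L).all fun r1 => (List.range L).all fun r2 =>
    decide (-(getF ft r1 r2).1 ≤ Mz) && decide ((getF ft r1 r2).2 ≤ Mz)

/-- `Q₀ = Σ_r f(r)⁴`. [folklore] -/
def xcQ0 (L : ℕ) (ft : List (List Iv)) : Iv :=
  psum (fun r1 => psum (fun r2 => isqP (isqP (getF ft r1 r2))) L) L

/-- the regular-weight indicator: `a ∉ {0, x̂}`. [folklore] -/
def notCore (r1 r2 : ℕ) : Bool := !((r1 == 0 && r2 == 0) || (r1 == 1 && r2 == 0))

/-- `R̄ = Σ_{a ∉ {0,x̂}} (D_x f(a))²`. [folklore] -/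
def xcRbar (L : ℕ) (gx : List (List Iv)) : Iv :=
  psum (fun r1 => psum (fun r2 => if notCore r1 r2 then isqP (getF gx r1 r2) else (0, 0)) L) L

/-- `X = Σ_{a ∉ {0,x̂}} (D_x f(a))² (1 − cos θ(a₁ − 1))`. [folklore] -/
def xcX (L : ℕ) (gx : List (List Iv)) (ct : List Iv) : Iv :=
  psum (fun r1 => psum (fun r2 => if notCore r1 r2 then
    imul (isqP (getF gx r1 r2)) (isub ione (getIv ct ((r1 + (L - 1)) % L))) else (0, 0)) L) L

/-- the regular-site indicator: `a ≠ 0` and `a` not a nearest neighbour. [folklore] -/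
def isRegN (L r1 r2 : ℕ) : Bool :=
  !((r1 == 0 && r2 == 0) || (r1 == 1 && r2 == 0) || (r1 == L - 1 && r2 == 0) || (r1 == 0 && r2 == 1) || (r1 == 0 && r2 == L - 1))

/-- `ψ_{e,e'} = Σ_{a regular} D_e f(a) D_{e'} f(a)` (`= Σ D_e s D_{e'} s`). [folklore] -/
def xcPsiPair (L : ℕ) (gx : List (List Iv)) (j j' : ℕ) : Iv :=
  psum (fun r1 => psum (fun r2 => if isRegN L r1 r2 then imul (gradAt L gx j r1 r2) (gradAt L gx j' r1 r2) else (0, 0)) L) L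

/-- `Ψ = Σ_{e,e'} ψ_{e,e'}²`. [folklore] -/
def xcPsi (L : ℕ) (gx : List (List Iv)) : Iv :=
  psum (fun j => psum (fun j' => isqP (xcPsiPair L gx j j')) 4) 4

/-- `C0(x̂, b)` by `C0Explicit`: `−½ Σ_e [f(c) D_e f(x̂) D_e f(b) + f(b) D_{−e} f(x̂) D_e f(c) + f(x̂) D_e f(b) D_e f(c)]`, `c = b − x̂`. [folklore] -/
def xcC0x (L : ℕ) (ft gx : List (List Iv)) (b1 b2 : ℕ) : Iv :=
  let c1 := (b1 + (L - 1)) % L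
  ineg (idivn (psum (fun j =>
    iadd (iadd (imul (imul (getF ft c1 b2) (gradAt L gx j 1 0)) (gradAt L gx j b1 b2))
      (imul (imul (getF ft b1 b2) (gradAt L gx (negDir j) 1 0)) (gradAt L gx j c1 b2)))
      (imul (imul (getF ft 1 0) (gradAt L gx j b1 b2)) (gradAt L gx j c1 b2))) 4) 2)

/-- `Σ_{b ∉ {0, x̂}} C0(x̂, b)²`. [folklore] -/
def xcRowSum (L : ℕ) (ft gx : List (List Iv)) : Iv :=
  psum (fun b1 => psum (fun b2 => if notCore b1 b2 then isqP (xcC0x L ft gx b1 b2) else (0, 0)) L) L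

/-! ## The brackets -/

/-- the row-C data of a cell. -/
structure XCObj where
  /-- `M·D` (integer upper bound of `sup|f|·D`) -/
  M : ℤ
  /-- `Chi ≥ cs2` (upper end used) -/
  chi : Iv
  /-- `Nhi ≥ ‖C0′‖²` (upper end used) -/
  nhi : Iv
  /-- `Tlo·D` -/
  tlo : ℤ
  /-- `Thi·D` -/
  thi : ℤ
  /-- `η·D`-interval -/
  eta : Iv

/-- `T⁺⁻·D`: the lower end of `3λ + min(Q⁻/P⁻, Q⁻/P⁺)`. [folklore] -/
def tPlusLo (S : XBScal) (O : XBObj) : ℤ :=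
  (iscale 3 S.lam).1 + min (imul (ipt O.Q.1) (iinv (ipt O.P.1))).1 (imul (ipt O.Q.1) (iinv (ipt O.P.2))).1

/-- ★ the row-C objects of the cell from the tables. [folklore] -/
def xcObj (L : ℕ) (la lb : ℤ) (S : XBScal) (O : XBObj) : XCObj :=
  let V : ℕ := L * L
  let ft := fTab4 L la lb
  let gx := gTab4 L la lb
  let ct := cosTab L
  let Mz := xcM L ft
  let M : Iv := ipt Mz
  let M2 := imul M M
  let fnn2 := isqP (getF ft 1 0)
  let Q0 := xcQ0 L ft
  let Rb := xcRbar L gx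
  let X := xcX L gx ct
  let Gam := iscale 2 (imul M2 (iadd Rb (iscale 2 fnn2)))
  let inner := imul (iscale 4 (imul Q0 X)) (imul Gam Rb)
  let chi := iadd (iadd (iscale 4 (imul (imul S.eps1 Q0) X))
      (imul (imul S.eps1 Rb) (iadd Gam (iscale 2 (imul fnn2 M2)))))
      (iscale 2 (imul S.eps1 (isqrt inner)))
  let nhi := iadd (idivn (iscale 9 (imul M2 (xcPsi L gx))) 4) (iscale 12 (xcRowSum L ft gx))
  { M := Mz, chi := chi, nhi := nhi, tlo := tPlusLo S O, thi := tPlusHi S O, eta := idivn (iscale V S.lam) 4 }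

/-- the square `(3√Chi⁺ + 3√Nhi⁺)²·D` bound (upper end) in fixed point. [folklore] -/
def sqSum (C : XCObj) : ℤ :=
  let s := iadd (iscale 3 (isqrt C.chi)) (iscale 3 (isqrt C.nhi))
  (imul (ipt s.2) (ipt s.2)).2

/-- the right side `b·η⁻·(2ε₁⁻ − Thi)·3V²·Tlo` (lower end, `b ≥ 0`) in fixed point. [folklore] -/
def rhsLo (L : ℕ) (S : XBScal) (C : XCObj) (bn bd : ℕ) : ℤ :=
  (idivn (iscale (bn * (3 * (L * L) ^ 2)) (imul (imul (ipt C.eta.1) (isub (iscale 2 (ipt S.eps1.1)) (ipt C.thi))) (ipt C.tlo))) bd).1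

/-- ★ THE COMBINED CELL CERTIFICATE (row `N₁` with constant `c`, row C with constant `b = bn/bd`). [folklore] -/
def xbcCellOK (L : ℕ) (la lb : ℤ) (c : ℚ) (bn bd : ℕ) : Bool :=
  let E := xbEval L la lb
  let C := xcObj L la lb E.1 E.2
  (groundCellCheck L la lb && xbScalOK L la lb && decide (0 < E.2.P.1) && decide (0 ≤ c) &&
    decide (c * (((3 * ((L : ℤ) * L) ^ 2 * tPlusHi E.1 E.2 : ℤ)) : ℚ) ≤ ((n1Lo E.1 E.2 : ℤ) : ℚ))) &&
  (decide (0 < bd) && xcMok L (fTab4 L la lb) C.M && decide (0 ≤ C.tlo) && decide (C.thi ≤ 2 * E.1.eps1.1) &&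
    decide (0 ≤ C.eta.1) && decide (sqSum C ≤ rhsLo L E.1 C bn bd))

end FinXB

end Summit.HubbardSuperconductivity.HubbardSuperconductivity.Theorems.AnisotropyChord.Transfer.Fibre3
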